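import Summits.CriticalPhenomena.PercolationContinuityZ3.Theorems.PercNearOneGluingNoHeavyLowerTailSahiE3ExchangeCross
import Mathlib.Tactic.Linarith
import Mathlib.Tactic.Ring
import Mathlib.Tactic.Positivity
import HarnessLib
import HarnessLib.Audit

/-!
# `NoHeavyLowerTail` (crux stmt-CriticalPhenomena-4575), Sahi programme P4: the 2×2 exchange lemma — sub-pair packings and the empty-layer classes

Support file (cell `prim-l12`, seat P4, generation 21; `--supports stmt-CriticalPhenomena-4575`).  No named facts, no sorries;
standard axioms; def-free.

Context (HOME prim-l12-p4/FROM-prim-l12-p4-gen21-SATURATED-EXCHANGE.md; predecessor file `…SahiE3ExchangeCross`).  The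
2×2 exchange lemma of the OR-peel (gen 20) asks, for a Harris block `(B, w, V)` with a pair-certificate `R ≥ 0` on `V`
(`R(X∩Y∩V) ≥ need(X,Y) := w(X)w(Y∩V) + w(Y)w(X∩V) − w(V)w(X)w(Y)` for up-sets) and a configuration of up-sets
`O ⊆ K∩L`, `K∪L ⊆ P`, `O' ⊆ K'∩L'`, `K'∪L' ⊆ P'`, that
  `w(PP'V) + w(OO'V) − w(P)w(O'V) − w(P')w(OV) + R(KK'V) + R(LL'V) − need(K,L') − need(L,K') + (1−v)·[bracket] ≥ 0`.
`…SahiE3ExchangeCross` proved it when the crossing cells `Ξ₁ = V∩(K∖L)∩(L'∖K')`, `Ξ₂ = V∩(L∖K)∩(K'∖L')` are empty.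
Gen 21 (this seat) found numerically that in general the supplies `R(KK'V) + R(LL'V)` must be certified by SUB-PAIRS whose
footprints avoid the crossing cells (the LP minimum over the pair polytope is always an integral two-set packing), and that the
configurations whose `y = 0` layer is empty on one of the two sides (`L = O = ∅`, resp. `K = O = ∅`) — a class with `Ξ ≠ ∅` in
general — are certified by the single sub-pair `(K, K'∩L')` (resp. `(L, K'∩L')`).  This file proves:
* `sum_inter_le_of_subset`: bookkeeping — a sub-pair footprint inside `K∩K'` draws on the supply `R(KK'V)`;
* `union_inter_le`: the pointwise inequality `1_{K'} + 1_{L'} ≤ 1_{P'} + 1_{K'∩L'}` for `K', L' ⊆ P'`, summed against a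
  nonnegative weight on any trace set `T` (used with `T = V` and `T = univ`);
* `exchange_of_emptyLayer₂ / ₁`: the exchange lemma (brackets of type 2 and 1) when `L = O = ∅`, from the ONE pair
  inequality at `(K, K'∩L')`, Harris for `(P, P'∩V)` and `(P, P')`, and the nestings — the slack is EXACTLY
  `Har(P;P'_V) + [w(P)·w((P'∖O')V) − w(K)·w((L'∖K'L')V)] + [(1−v)w(P)(w(P')−w(K')) − w(L'∖K'L')·(w(KV) − v·w(K))] + (1−v)[Har(P,P') + …]`,
  each bracket nonnegative (numerically an identity, lab/e41);
* `exchange_of_emptyLayerK₂ / ₁`: the twin class `K = O = ∅` from the pair `(L, K'∩L')`.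
The general case (both layers nonempty on both sides) is the open part; see the HOME memo for the saturated-pair form.
-/

namespace Summit.CriticalPhenomena.PercolationContinuityZ3.Theorems.SahiE3ExchangeEmptyLayer

open Finset SahiE3DimerPacking SahiE3ExchangeCross
open scoped BigOperators

variable {B : Type*} [DecidableEq B]

/-- **Sub-pair bookkeeping.**  If `R ≥ 0` on `V` and `X ∩ Y ⊆ Z`, then `R(X∩Y∩V) ≤ R(Z∩V)`: a pair whose footprint lies inside
`K∩K'` (or `L∩L'`) draws on the corresponding supply of the exchange lemma. [folklore] -/
theorem sum_inter_le_of_subset (R : B → ℝ) (V X Y Z : Finset B) (hR : ∀ b ∈ V, 0 ≤ R b) (h : X ∩ Y ⊆ Z) :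
    ∑ b ∈ (X ∩ Y) ∩ V, R b ≤ ∑ b ∈ Z ∩ V, R b := by
  apply Finset.sum_le_sum_of_subset_of_nonneg (Finset.inter_subset_inter h le_rfl)
  intro b hb _
  exact hR b (Finset.mem_inter.1 hb).2

/-- **Union–intersection inequality.**  For `w ≥ 0` on a trace set `T` and `K' ⊆ P'`, `L' ⊆ P'`:
`w(K'T) + w(L'T) ≤ w(P'T) + w((K'∩L')T)` (pointwise `1_{K'} + 1_{L'} = 1_{K'∪L'} + 1_{K'∩L'} ≤ 1_{P'} + 1_{K'∩L'}`). [folklore] -/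
theorem union_inter_le (w : B → ℝ) (T K' L' P' : Finset B) (hw : ∀ b ∈ T, 0 ≤ w b)
    (hKP : K' ⊆ P') (hLP : L' ⊆ P') :
    ∑ b ∈ K' ∩ T, w b + ∑ b ∈ L' ∩ T, w b ≤ ∑ b ∈ P' ∩ T, w b + ∑ b ∈ (K' ∩ L') ∩ T, w b := by
  simp only [sum_inter_eq_sum_ite, ← Finset.sum_add_distrib]
  refine Finset.sum_le_sum fun b hb => ?_
  have hwb := hw b hb
  simp only [Finset.mem_inter]
  by_cases hk : b ∈ K' <;> by_cases hl : b ∈ L' <;> by_cases hp : b ∈ P' <;>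
    simp only [hk, hl, hp, and_true, and_false, and_self, ↓reduceIte, add_zero, zero_add, le_refl] <;>
    first
      | exact absurd (hKP hk) hp
      | exact absurd (hLP hl) hp
      | linarith

/-- **The exchange lemma for an empty `y = 0` layer (`L = O = ∅`), bracket of type 2.**  `B` finite, `w ≥ 0` of total mass
`1`, `V` the slot (`v = w(V)`), `R ≥ 0` on `V` satisfying the pair inequality at the single sub-pair `(K, K'∩L')`, Harris for
`(P, P'∩V)` and `(P, P')`, and nestings `K ⊆ P`, `O' ⊆ K'`, `O' ⊆ L'`, `K' ⊆ P'`, `L' ⊆ P'`.  Then (the `L = O = ∅`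
specialisation of the type-2 exchange expression of `…SahiE3ExchangeCross.exchange_of_noCross₂`)
`w(PP'V) − w(P)w(O'V) + R(KK'V) − need(K,L') + (1−v)[w(PP') − pp' + (p−k)(p'−l') + p(p'−k')] ≥ 0`.
The crossing cell `V∩K∩(L'∖K')` may be nonempty here. [this work] -/
theorem exchange_of_emptyLayer₂ [Fintype B] (w R : B → ℝ) (hw : ∀ b, 0 ≤ w b) (hw1 : ∑ b, w b = 1)
    (V K P K' L' P' O' : Finset B) (hR : ∀ b ∈ V, 0 ≤ R b)
    (hKP : K ⊆ P) (hOK' : O' ⊆ K') (hOL' : O' ⊆ L') (hKP' : K' ⊆ P') (hLP' : L' ⊆ P')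
    (hpair : (∑ b ∈ K, w b) * (∑ b ∈ (K' ∩ L') ∩ V, w b) + (∑ b ∈ K' ∩ L', w b) * (∑ b ∈ K ∩ V, w b)
        - (∑ b ∈ V, w b) * (∑ b ∈ K, w b) * (∑ b ∈ K' ∩ L', w b) ≤ ∑ b ∈ (K ∩ (K' ∩ L')) ∩ V, R b)
    (hHarV : (∑ b ∈ P, w b) * (∑ b ∈ P' ∩ V, w b) ≤ ∑ b ∈ (P ∩ P') ∩ V, w b)
    (hHar₃ : (∑ b ∈ P, w b) * (∑ b ∈ P', w b) ≤ ∑ b ∈ P ∩ P', w b) :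
    0 ≤ (∑ b ∈ (P ∩ P') ∩ V, w b) - (∑ b ∈ P, w b) * (∑ b ∈ O' ∩ V, w b)
        + (∑ b ∈ (K ∩ K') ∩ V, R b)
        - ((∑ b ∈ K, w b) * (∑ b ∈ L' ∩ V, w b) + (∑ b ∈ L', w b) * (∑ b ∈ K ∩ V, w b)
            - (∑ b ∈ V, w b) * (∑ b ∈ K, w b) * (∑ b ∈ L', w b))
        + (1 - ∑ b ∈ V, w b) * ((∑ b ∈ P ∩ P', w b) - (∑ b ∈ P, w b) * (∑ b ∈ P', w b)
            + ((∑ b ∈ P, w b) - ∑ b ∈ K, w b) * ((∑ b ∈ P', w b) - ∑ b ∈ L', w b)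
            + (∑ b ∈ P, w b) * ((∑ b ∈ P', w b) - ∑ b ∈ K', w b)) := by
  -- the sub-pair (K, K'∩L') draws on the supply R(KK'V)
  have hsup : ∑ b ∈ (K ∩ (K' ∩ L')) ∩ V, R b ≤ ∑ b ∈ (K ∩ K') ∩ V, R b :=
    sum_inter_le_of_subset R V K (K' ∩ L') (K ∩ K') hR
      (by intro b hb; simp only [Finset.mem_inter] at hb ⊢; exact ⟨hb.1, hb.2.1⟩)
  -- nested four-set inequalities, traced on V and untraced
  have h4V := union_inter_le w V K' L' P' (fun b _ => hw b) hKP' hLP'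
  have h4 : ∑ b ∈ K', w b + ∑ b ∈ L', w b ≤ ∑ b ∈ P', w b + ∑ b ∈ K' ∩ L', w b := by
    have := union_inter_le w (Finset.univ : Finset B) K' L' P' (fun b _ => hw b) hKP' hLP'
    simpa only [Finset.inter_univ] using this
  have hOK'V : ∑ b ∈ O' ∩ V, w b ≤ ∑ b ∈ K' ∩ V, w b :=
    sum_le_sum_of_subset' w hw (Finset.inter_subset_inter hOK' le_rfl)
  have hOL'V : ∑ b ∈ O' ∩ V, w b ≤ ∑ b ∈ L' ∩ V, w b :=
    sum_le_sum_of_subset' w hw (Finset.inter_subset_inter hOL' le_rfl)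
  have hML'w : ∑ b ∈ K' ∩ L', w b ≤ ∑ b ∈ L', w b := sum_le_sum_of_subset' w hw Finset.inter_subset_right
  have hMK'w : ∑ b ∈ K' ∩ L', w b ≤ ∑ b ∈ K', w b := sum_le_sum_of_subset' w hw Finset.inter_subset_left
  -- elementary mass facts
  have hv1 : ∑ b ∈ V, w b ≤ 1 := by
    rw [← hw1]; exact sum_le_sum_of_subset' w hw (Finset.subset_univ V)
  have hk0 : 0 ≤ ∑ b ∈ K, w b := Finset.sum_nonneg fun b _ => hw b
  have hkp : ∑ b ∈ K, w b ≤ ∑ b ∈ P, w b := sum_le_sum_of_subset' w hw hKP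
  have haK : ∑ b ∈ K ∩ V, w b ≤ ∑ b ∈ K, w b := sum_le_sum_of_subset' w hw Finset.inter_subset_left
  have haK0 : 0 ≤ ∑ b ∈ K ∩ V, w b := Finset.sum_nonneg fun b _ => hw b
  have hO0 : 0 ≤ ∑ b ∈ O', w b := Finset.sum_nonneg fun b _ => hw b
  have hMK' : ∑ b ∈ K' ∩ L', w b ≤ ∑ b ∈ K', w b := sum_le_sum_of_subset' w hw Finset.inter_subset_left
  have hML'V : ∑ b ∈ (K' ∩ L') ∩ V, w b ≤ ∑ b ∈ L' ∩ V, w b :=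
    sum_le_sum_of_subset' w hw (Finset.inter_subset_inter Finset.inter_subset_right le_rfl)
  have hlp' : ∑ b ∈ L', w b ≤ ∑ b ∈ P', w b := sum_le_sum_of_subset' w hw hLP'
  -- abbreviations
  set p := ∑ b ∈ P, w b with hp_def
  set k := ∑ b ∈ K, w b with hk_def
  set v := ∑ b ∈ V, w b with hv_def
  set aK := ∑ b ∈ K ∩ V, w b
  set p' := ∑ b ∈ P', w b
  set k' := ∑ b ∈ K', w b
  set l' := ∑ b ∈ L', w b
  set o' := ∑ b ∈ O', w b
  set m' := ∑ b ∈ K' ∩ L', w b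
  set aP' := ∑ b ∈ P' ∩ V, w b
  set aL' := ∑ b ∈ L' ∩ V, w b
  set aK' := ∑ b ∈ K' ∩ V, w b
  set aO' := ∑ b ∈ O' ∩ V, w b
  set aM' := ∑ b ∈ (K' ∩ L') ∩ V, w b
  -- F2: p·(aP' − aO') ≥ k·(aL' − aM')
  have F2 : k * (aL' - aM') ≤ p * (aP' - aO') := by
    have h1 : aL' - aM' ≤ aP' - aO' := by linarith
    have h2 : 0 ≤ aL' - aM' := by linarith
    calc k * (aL' - aM') ≤ k * (aP' - aO') := mul_le_mul_of_nonneg_left h1 hk0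
      _ ≤ p * (aP' - aO') := mul_le_mul_of_nonneg_right hkp (by linarith)
  -- F3: (l' − m')·(aK − v·k) ≤ (1−v)·p·(p' − k')
  have F3 : (l' - m') * (aK - v * k) ≤ (1 - v) * (p * (p' - k')) := by
    have h1 : aK - v * k ≤ (1 - v) * k := by nlinarith
    have h2 : 0 ≤ l' - m' := by linarith
    have h3 : l' - m' ≤ p' - k' := by linarith
    have h4' : 0 ≤ (1 - v) * k := mul_nonneg (by linarith) hk0
    calc (l' - m') * (aK - v * k) ≤ (l' - m') * ((1 - v) * k) := mul_le_mul_of_nonneg_left h1 h2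
      _ ≤ (p' - k') * ((1 - v) * k) := mul_le_mul_of_nonneg_right h3 h4'
      _ ≤ (p' - k') * ((1 - v) * p) :=
          mul_le_mul_of_nonneg_left (mul_le_mul_of_nonneg_left hkp (by linarith)) (by linarith)
      _ = (1 - v) * (p * (p' - k')) := by ring
  have F4 : 0 ≤ (1 - v) * ((∑ b ∈ P ∩ P', w b) - p * p') := mul_nonneg (by linarith) (by linarith)
  have F5 : 0 ≤ (1 - v) * ((p - k) * (p' - l')) := mul_nonneg (by linarith) (mul_nonneg (by linarith) (by linarith))
  nlinarith [hsup, hpair, hHarV, F2, F3, F4, F5]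

/-- **The exchange lemma for an empty `y = 0` layer (`L = O = ∅`), bracket of type 1** (shape of `D₁`): same hypotheses,
bracket `[w(PP') − pp' + (p−k)(k'−o') + p(p'−k')]`. [this work] -/
theorem exchange_of_emptyLayer₁ [Fintype B] (w R : B → ℝ) (hw : ∀ b, 0 ≤ w b) (hw1 : ∑ b, w b = 1)
    (V K P K' L' P' O' : Finset B) (hR : ∀ b ∈ V, 0 ≤ R b)
    (hKP : K ⊆ P) (hOK' : O' ⊆ K') (hOL' : O' ⊆ L') (hKP' : K' ⊆ P') (hLP' : L' ⊆ P')
    (hpair : (∑ b ∈ K, w b) * (∑ b ∈ (K' ∩ L') ∩ V, w b) + (∑ b ∈ K' ∩ L', w b) * (∑ b ∈ K ∩ V, w b)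
        - (∑ b ∈ V, w b) * (∑ b ∈ K, w b) * (∑ b ∈ K' ∩ L', w b) ≤ ∑ b ∈ (K ∩ (K' ∩ L')) ∩ V, R b)
    (hHarV : (∑ b ∈ P, w b) * (∑ b ∈ P' ∩ V, w b) ≤ ∑ b ∈ (P ∩ P') ∩ V, w b)
    (hHar₃ : (∑ b ∈ P, w b) * (∑ b ∈ P', w b) ≤ ∑ b ∈ P ∩ P', w b) :
    0 ≤ (∑ b ∈ (P ∩ P') ∩ V, w b) - (∑ b ∈ P, w b) * (∑ b ∈ O' ∩ V, w b)
        + (∑ b ∈ (K ∩ K') ∩ V, R b)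
        - ((∑ b ∈ K, w b) * (∑ b ∈ L' ∩ V, w b) + (∑ b ∈ L', w b) * (∑ b ∈ K ∩ V, w b)
            - (∑ b ∈ V, w b) * (∑ b ∈ K, w b) * (∑ b ∈ L', w b))
        + (1 - ∑ b ∈ V, w b) * ((∑ b ∈ P ∩ P', w b) - (∑ b ∈ P, w b) * (∑ b ∈ P', w b)
            + ((∑ b ∈ P, w b) - ∑ b ∈ K, w b) * ((∑ b ∈ K', w b) - ∑ b ∈ O', w b)
            + (∑ b ∈ P, w b) * ((∑ b ∈ P', w b) - ∑ b ∈ K', w b)) := by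
  have hsup : ∑ b ∈ (K ∩ (K' ∩ L')) ∩ V, R b ≤ ∑ b ∈ (K ∩ K') ∩ V, R b :=
    sum_inter_le_of_subset R V K (K' ∩ L') (K ∩ K') hR
      (by intro b hb; simp only [Finset.mem_inter] at hb ⊢; exact ⟨hb.1, hb.2.1⟩)
  have h4V := union_inter_le w V K' L' P' (fun b _ => hw b) hKP' hLP'
  have h4 : ∑ b ∈ K', w b + ∑ b ∈ L', w b ≤ ∑ b ∈ P', w b + ∑ b ∈ K' ∩ L', w b := by
    have := union_inter_le w (Finset.univ : Finset B) K' L' P' (fun b _ => hw b) hKP' hLP'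
    simpa only [Finset.inter_univ] using this
  have hOK'V : ∑ b ∈ O' ∩ V, w b ≤ ∑ b ∈ K' ∩ V, w b :=
    sum_le_sum_of_subset' w hw (Finset.inter_subset_inter hOK' le_rfl)
  have hOL'V : ∑ b ∈ O' ∩ V, w b ≤ ∑ b ∈ L' ∩ V, w b :=
    sum_le_sum_of_subset' w hw (Finset.inter_subset_inter hOL' le_rfl)
  have hML'w : ∑ b ∈ K' ∩ L', w b ≤ ∑ b ∈ L', w b := sum_le_sum_of_subset' w hw Finset.inter_subset_right
  have hMK'w : ∑ b ∈ K' ∩ L', w b ≤ ∑ b ∈ K', w b := sum_le_sum_of_subset' w hw Finset.inter_subset_left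
  have hv1 : ∑ b ∈ V, w b ≤ 1 := by
    rw [← hw1]; exact sum_le_sum_of_subset' w hw (Finset.subset_univ V)
  have hk0 : 0 ≤ ∑ b ∈ K, w b := Finset.sum_nonneg fun b _ => hw b
  have hkp : ∑ b ∈ K, w b ≤ ∑ b ∈ P, w b := sum_le_sum_of_subset' w hw hKP
  have haK : ∑ b ∈ K ∩ V, w b ≤ ∑ b ∈ K, w b := sum_le_sum_of_subset' w hw Finset.inter_subset_left
  have hO0 : 0 ≤ ∑ b ∈ O', w b := Finset.sum_nonneg fun b _ => hw b
  have hMK' : ∑ b ∈ K' ∩ L', w b ≤ ∑ b ∈ K', w b := sum_le_sum_of_subset' w hw Finset.inter_subset_left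
  have hOK'w : ∑ b ∈ O', w b ≤ ∑ b ∈ K', w b := sum_le_sum_of_subset' w hw hOK'
  have hML'V : ∑ b ∈ (K' ∩ L') ∩ V, w b ≤ ∑ b ∈ L' ∩ V, w b :=
    sum_le_sum_of_subset' w hw (Finset.inter_subset_inter Finset.inter_subset_right le_rfl)
  have hlp' : ∑ b ∈ L', w b ≤ ∑ b ∈ P', w b := sum_le_sum_of_subset' w hw hLP'
  set p := ∑ b ∈ P, w b with hp_def
  set k := ∑ b ∈ K, w b with hk_def
  set v := ∑ b ∈ V, w b with hv_def
  set aK := ∑ b ∈ K ∩ V, w b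
  set p' := ∑ b ∈ P', w b
  set k' := ∑ b ∈ K', w b
  set l' := ∑ b ∈ L', w b
  set o' := ∑ b ∈ O', w b
  set m' := ∑ b ∈ K' ∩ L', w b
  set aP' := ∑ b ∈ P' ∩ V, w b
  set aL' := ∑ b ∈ L' ∩ V, w b
  set aK' := ∑ b ∈ K' ∩ V, w b
  set aO' := ∑ b ∈ O' ∩ V, w b
  set aM' := ∑ b ∈ (K' ∩ L') ∩ V, w b
  have F2 : k * (aL' - aM') ≤ p * (aP' - aO') := by
    have h1 : aL' - aM' ≤ aP' - aO' := by linarith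
    have h2 : 0 ≤ aL' - aM' := by linarith
    calc k * (aL' - aM') ≤ k * (aP' - aO') := mul_le_mul_of_nonneg_left h1 hk0
      _ ≤ p * (aP' - aO') := mul_le_mul_of_nonneg_right hkp (by linarith)
  have F3 : (l' - m') * (aK - v * k) ≤ (1 - v) * (p * (p' - k')) := by
    have h1 : aK - v * k ≤ (1 - v) * k := by nlinarith
    have h2 : 0 ≤ l' - m' := by linarith
    have h3 : l' - m' ≤ p' - k' := by linarith
    have h4' : 0 ≤ (1 - v) * k := mul_nonneg (by linarith) hk0
    calc (l' - m') * (aK - v * k) ≤ (l' - m') * ((1 - v) * k) := mul_le_mul_of_nonneg_left h1 h2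
      _ ≤ (p' - k') * ((1 - v) * k) := mul_le_mul_of_nonneg_right h3 h4'
      _ ≤ (p' - k') * ((1 - v) * p) :=
          mul_le_mul_of_nonneg_left (mul_le_mul_of_nonneg_left hkp (by linarith)) (by linarith)
      _ = (1 - v) * (p * (p' - k')) := by ring
  have F4 : 0 ≤ (1 - v) * ((∑ b ∈ P ∩ P', w b) - p * p') := mul_nonneg (by linarith) (by linarith)
  have F5 : 0 ≤ (1 - v) * ((p - k) * (k' - o')) := mul_nonneg (by linarith) (mul_nonneg (by linarith) (by linarith))
  nlinarith [hsup, hpair, hHarV, F2, F3, F4, F5]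

/-- **The twin class `K = O = ∅` (empty `z = 0` layer on the unprimed side), bracket of type 2**: from the single pair
inequality at `(L, K'∩L')` (footprint inside `L∩L'`), Harris for `(P, P'∩V)`, `(P, P')`, and the nestings `L ⊆ P`,
`O' ⊆ K'`, `O' ⊆ L'`, `K' ⊆ P'`, `L' ⊆ P'`:
`w(PP'V) − w(P)w(O'V) + R(LL'V) − need(L,K') + (1−v)[w(PP') − pp' + p(p'−l') + (p−l)(p'−k')] ≥ 0`. [this work] -/
theorem exchange_of_emptyLayerK₂ [Fintype B] (w R : B → ℝ) (hw : ∀ b, 0 ≤ w b) (hw1 : ∑ b, w b = 1)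
    (V L P K' L' P' O' : Finset B) (hR : ∀ b ∈ V, 0 ≤ R b)
    (hLP : L ⊆ P) (hOK' : O' ⊆ K') (hOL' : O' ⊆ L') (hKP' : K' ⊆ P') (hLP' : L' ⊆ P')
    (hpair : (∑ b ∈ L, w b) * (∑ b ∈ (K' ∩ L') ∩ V, w b) + (∑ b ∈ K' ∩ L', w b) * (∑ b ∈ L ∩ V, w b)
        - (∑ b ∈ V, w b) * (∑ b ∈ L, w b) * (∑ b ∈ K' ∩ L', w b) ≤ ∑ b ∈ (L ∩ (K' ∩ L')) ∩ V, R b)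
    (hHarV : (∑ b ∈ P, w b) * (∑ b ∈ P' ∩ V, w b) ≤ ∑ b ∈ (P ∩ P') ∩ V, w b)
    (hHar₃ : (∑ b ∈ P, w b) * (∑ b ∈ P', w b) ≤ ∑ b ∈ P ∩ P', w b) :
    0 ≤ (∑ b ∈ (P ∩ P') ∩ V, w b) - (∑ b ∈ P, w b) * (∑ b ∈ O' ∩ V, w b)
        + (∑ b ∈ (L ∩ L') ∩ V, R b)
        - ((∑ b ∈ L, w b) * (∑ b ∈ K' ∩ V, w b) + (∑ b ∈ K', w b) * (∑ b ∈ L ∩ V, w b)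
            - (∑ b ∈ V, w b) * (∑ b ∈ L, w b) * (∑ b ∈ K', w b))
        + (1 - ∑ b ∈ V, w b) * ((∑ b ∈ P ∩ P', w b) - (∑ b ∈ P, w b) * (∑ b ∈ P', w b)
            + (∑ b ∈ P, w b) * ((∑ b ∈ P', w b) - ∑ b ∈ L', w b)
            + ((∑ b ∈ P, w b) - ∑ b ∈ L, w b) * ((∑ b ∈ P', w b) - ∑ b ∈ K', w b)) := by
  have hsup : ∑ b ∈ (L ∩ (K' ∩ L')) ∩ V, R b ≤ ∑ b ∈ (L ∩ L') ∩ V, R b :=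
    sum_inter_le_of_subset R V L (K' ∩ L') (L ∩ L') hR
      (by intro b hb; simp only [Finset.mem_inter] at hb ⊢; exact ⟨hb.1, hb.2.2⟩)
  have h4V := union_inter_le w V K' L' P' (fun b _ => hw b) hKP' hLP'
  have h4 : ∑ b ∈ K', w b + ∑ b ∈ L', w b ≤ ∑ b ∈ P', w b + ∑ b ∈ K' ∩ L', w b := by
    have := union_inter_le w (Finset.univ : Finset B) K' L' P' (fun b _ => hw b) hKP' hLP'
    simpa only [Finset.inter_univ] using this
  have hOK'V : ∑ b ∈ O' ∩ V, w b ≤ ∑ b ∈ K' ∩ V, w b :=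
    sum_le_sum_of_subset' w hw (Finset.inter_subset_inter hOK' le_rfl)
  have hOL'V : ∑ b ∈ O' ∩ V, w b ≤ ∑ b ∈ L' ∩ V, w b :=
    sum_le_sum_of_subset' w hw (Finset.inter_subset_inter hOL' le_rfl)
  have hML'w : ∑ b ∈ K' ∩ L', w b ≤ ∑ b ∈ L', w b := sum_le_sum_of_subset' w hw Finset.inter_subset_right
  have hMK'w : ∑ b ∈ K' ∩ L', w b ≤ ∑ b ∈ K', w b := sum_le_sum_of_subset' w hw Finset.inter_subset_left
  have hv1 : ∑ b ∈ V, w b ≤ 1 := by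
    rw [← hw1]; exact sum_le_sum_of_subset' w hw (Finset.subset_univ V)
  have hl0 : 0 ≤ ∑ b ∈ L, w b := Finset.sum_nonneg fun b _ => hw b
  have hlp : ∑ b ∈ L, w b ≤ ∑ b ∈ P, w b := sum_le_sum_of_subset' w hw hLP
  have haL : ∑ b ∈ L ∩ V, w b ≤ ∑ b ∈ L, w b := sum_le_sum_of_subset' w hw Finset.inter_subset_left
  have hO0 : 0 ≤ ∑ b ∈ O', w b := Finset.sum_nonneg fun b _ => hw b
  have hML' : ∑ b ∈ K' ∩ L', w b ≤ ∑ b ∈ L', w b := sum_le_sum_of_subset' w hw Finset.inter_subset_right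
  have hMK'V : ∑ b ∈ (K' ∩ L') ∩ V, w b ≤ ∑ b ∈ K' ∩ V, w b :=
    sum_le_sum_of_subset' w hw (Finset.inter_subset_inter Finset.inter_subset_left le_rfl)
  have hkp' : ∑ b ∈ K', w b ≤ ∑ b ∈ P', w b := sum_le_sum_of_subset' w hw hKP'
  set p := ∑ b ∈ P, w b with hp_def
  set l := ∑ b ∈ L, w b with hl_def
  set v := ∑ b ∈ V, w b with hv_def
  set aL := ∑ b ∈ L ∩ V, w b
  set p' := ∑ b ∈ P', w b
  set k' := ∑ b ∈ K', w b
  set l' := ∑ b ∈ L', w b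
  set o' := ∑ b ∈ O', w b
  set m' := ∑ b ∈ K' ∩ L', w b
  set aP' := ∑ b ∈ P' ∩ V, w b
  set aK' := ∑ b ∈ K' ∩ V, w b
  set aL' := ∑ b ∈ L' ∩ V, w b
  set aO' := ∑ b ∈ O' ∩ V, w b
  set aM' := ∑ b ∈ (K' ∩ L') ∩ V, w b
  have F2 : l * (aK' - aM') ≤ p * (aP' - aO') := by
    have h1 : aK' - aM' ≤ aP' - aO' := by linarith
    have h2 : 0 ≤ aK' - aM' := by linarith
    calc l * (aK' - aM') ≤ l * (aP' - aO') := mul_le_mul_of_nonneg_left h1 hl0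
      _ ≤ p * (aP' - aO') := mul_le_mul_of_nonneg_right hlp (by linarith)
  have F3 : (k' - m') * (aL - v * l) ≤ (1 - v) * (p * (p' - l')) := by
    have h1 : aL - v * l ≤ (1 - v) * l := by nlinarith
    have h2 : 0 ≤ k' - m' := by linarith
    have h3 : k' - m' ≤ p' - l' := by linarith
    have h4' : 0 ≤ (1 - v) * l := mul_nonneg (by linarith) hl0
    calc (k' - m') * (aL - v * l) ≤ (k' - m') * ((1 - v) * l) := mul_le_mul_of_nonneg_left h1 h2
      _ ≤ (p' - l') * ((1 - v) * l) := mul_le_mul_of_nonneg_right h3 h4'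
      _ ≤ (p' - l') * ((1 - v) * p) :=
          mul_le_mul_of_nonneg_left (mul_le_mul_of_nonneg_left hlp (by linarith)) (by linarith)
      _ = (1 - v) * (p * (p' - l')) := by ring
  have F4 : 0 ≤ (1 - v) * ((∑ b ∈ P ∩ P', w b) - p * p') := mul_nonneg (by linarith) (by linarith)
  have F5 : 0 ≤ (1 - v) * ((p - l) * (p' - k')) := mul_nonneg (by linarith) (mul_nonneg (by linarith) (by linarith))
  nlinarith [hsup, hpair, hHarV, F2, F3, F4, F5]

/-- **The twin class `K = O = ∅`, bracket of type 1**: with `K = O = ∅` the type-1 bracket is `[w(PP') − pp' + p(k'−o') + p(p'−k')]`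
(`(p−k)(k'−o') + (p−o)(p'−k')` at `k = o = 0`); same hypotheses as `exchange_of_emptyLayerK₂`. [this work] -/
theorem exchange_of_emptyLayerK₁ [Fintype B] (w R : B → ℝ) (hw : ∀ b, 0 ≤ w b) (hw1 : ∑ b, w b = 1)
    (V L P K' L' P' O' : Finset B) (hR : ∀ b ∈ V, 0 ≤ R b)
    (hLP : L ⊆ P) (hOK' : O' ⊆ K') (hOL' : O' ⊆ L') (hKP' : K' ⊆ P') (hLP' : L' ⊆ P')
    (hpair : (∑ b ∈ L, w b) * (∑ b ∈ (K' ∩ L') ∩ V, w b) + (∑ b ∈ K' ∩ L', w b) * (∑ b ∈ L ∩ V, w b)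
        - (∑ b ∈ V, w b) * (∑ b ∈ L, w b) * (∑ b ∈ K' ∩ L', w b) ≤ ∑ b ∈ (L ∩ (K' ∩ L')) ∩ V, R b)
    (hHarV : (∑ b ∈ P, w b) * (∑ b ∈ P' ∩ V, w b) ≤ ∑ b ∈ (P ∩ P') ∩ V, w b)
    (hHar₃ : (∑ b ∈ P, w b) * (∑ b ∈ P', w b) ≤ ∑ b ∈ P ∩ P', w b) :
    0 ≤ (∑ b ∈ (P ∩ P') ∩ V, w b) - (∑ b ∈ P, w b) * (∑ b ∈ O' ∩ V, w b)
        + (∑ b ∈ (L ∩ L') ∩ V, R b)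
        - ((∑ b ∈ L, w b) * (∑ b ∈ K' ∩ V, w b) + (∑ b ∈ K', w b) * (∑ b ∈ L ∩ V, w b)
            - (∑ b ∈ V, w b) * (∑ b ∈ L, w b) * (∑ b ∈ K', w b))
        + (1 - ∑ b ∈ V, w b) * ((∑ b ∈ P ∩ P', w b) - (∑ b ∈ P, w b) * (∑ b ∈ P', w b)
            + (∑ b ∈ P, w b) * ((∑ b ∈ K', w b) - ∑ b ∈ O', w b)
            + (∑ b ∈ P, w b) * ((∑ b ∈ P', w b) - ∑ b ∈ K', w b)) := by
  have hsup : ∑ b ∈ (L ∩ (K' ∩ L')) ∩ V, R b ≤ ∑ b ∈ (L ∩ L') ∩ V, R b :=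
    sum_inter_le_of_subset R V L (K' ∩ L') (L ∩ L') hR
      (by intro b hb; simp only [Finset.mem_inter] at hb ⊢; exact ⟨hb.1, hb.2.2⟩)
  have h4V := union_inter_le w V K' L' P' (fun b _ => hw b) hKP' hLP'
  have h4 : ∑ b ∈ K', w b + ∑ b ∈ L', w b ≤ ∑ b ∈ P', w b + ∑ b ∈ K' ∩ L', w b := by
    have := union_inter_le w (Finset.univ : Finset B) K' L' P' (fun b _ => hw b) hKP' hLP'
    simpa only [Finset.inter_univ] using this
  have hOK'V : ∑ b ∈ O' ∩ V, w b ≤ ∑ b ∈ K' ∩ V, w b :=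
    sum_le_sum_of_subset' w hw (Finset.inter_subset_inter hOK' le_rfl)
  have hOL'V : ∑ b ∈ O' ∩ V, w b ≤ ∑ b ∈ L' ∩ V, w b :=
    sum_le_sum_of_subset' w hw (Finset.inter_subset_inter hOL' le_rfl)
  have hML'w : ∑ b ∈ K' ∩ L', w b ≤ ∑ b ∈ L', w b := sum_le_sum_of_subset' w hw Finset.inter_subset_right
  have hMK'w : ∑ b ∈ K' ∩ L', w b ≤ ∑ b ∈ K', w b := sum_le_sum_of_subset' w hw Finset.inter_subset_left
  have hv1 : ∑ b ∈ V, w b ≤ 1 := by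
    rw [← hw1]; exact sum_le_sum_of_subset' w hw (Finset.subset_univ V)
  have hl0 : 0 ≤ ∑ b ∈ L, w b := Finset.sum_nonneg fun b _ => hw b
  have hlp : ∑ b ∈ L, w b ≤ ∑ b ∈ P, w b := sum_le_sum_of_subset' w hw hLP
  have haL : ∑ b ∈ L ∩ V, w b ≤ ∑ b ∈ L, w b := sum_le_sum_of_subset' w hw Finset.inter_subset_left
  have hO0 : 0 ≤ ∑ b ∈ O', w b := Finset.sum_nonneg fun b _ => hw b
  have hML' : ∑ b ∈ K' ∩ L', w b ≤ ∑ b ∈ L', w b := sum_le_sum_of_subset' w hw Finset.inter_subset_right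
  have hOL'w : ∑ b ∈ O', w b ≤ ∑ b ∈ L', w b := sum_le_sum_of_subset' w hw hOL'
  have hMK'V : ∑ b ∈ (K' ∩ L') ∩ V, w b ≤ ∑ b ∈ K' ∩ V, w b :=
    sum_le_sum_of_subset' w hw (Finset.inter_subset_inter Finset.inter_subset_left le_rfl)
  have hkp' : ∑ b ∈ K', w b ≤ ∑ b ∈ P', w b := sum_le_sum_of_subset' w hw hKP'
  have hlp' : ∑ b ∈ L', w b ≤ ∑ b ∈ P', w b := sum_le_sum_of_subset' w hw hLP'
  set p := ∑ b ∈ P, w b with hp_def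
  set l := ∑ b ∈ L, w b with hl_def
  set v := ∑ b ∈ V, w b with hv_def
  set aL := ∑ b ∈ L ∩ V, w b
  set p' := ∑ b ∈ P', w b
  set k' := ∑ b ∈ K', w b
  set l' := ∑ b ∈ L', w b
  set o' := ∑ b ∈ O', w b
  set m' := ∑ b ∈ K' ∩ L', w b
  set aP' := ∑ b ∈ P' ∩ V, w b
  set aK' := ∑ b ∈ K' ∩ V, w b
  set aL' := ∑ b ∈ L' ∩ V, w b
  set aO' := ∑ b ∈ O' ∩ V, w b
  set aM' := ∑ b ∈ (K' ∩ L') ∩ V, w b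
  have F2 : l * (aK' - aM') ≤ p * (aP' - aO') := by
    have h1 : aK' - aM' ≤ aP' - aO' := by linarith
    have h2 : 0 ≤ aK' - aM' := by linarith
    calc l * (aK' - aM') ≤ l * (aP' - aO') := mul_le_mul_of_nonneg_left h1 hl0
      _ ≤ p * (aP' - aO') := mul_le_mul_of_nonneg_right hlp (by linarith)
  -- here the budget term is p·(k' − o') + p·(p' − k') = p·(p' − o') ≥ p·(p' − l') ≥ … (o' ≤ l')
  have F3 : (k' - m') * (aL - v * l) ≤ (1 - v) * (p * (k' - o') + p * (p' - k')) := by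
    have h1 : aL - v * l ≤ (1 - v) * l := by nlinarith
    have h2 : 0 ≤ k' - m' := by linarith
    have h3 : k' - m' ≤ p' - o' := by linarith
    have h4' : 0 ≤ (1 - v) * l := mul_nonneg (by linarith) hl0
    calc (k' - m') * (aL - v * l) ≤ (k' - m') * ((1 - v) * l) := mul_le_mul_of_nonneg_left h1 h2
      _ ≤ (p' - o') * ((1 - v) * l) := mul_le_mul_of_nonneg_right h3 h4'
      _ ≤ (p' - o') * ((1 - v) * p) :=
          mul_le_mul_of_nonneg_left (mul_le_mul_of_nonneg_left hlp (by linarith)) (by linarith)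
      _ = (1 - v) * (p * (k' - o') + p * (p' - k')) := by ring
  have F4 : 0 ≤ (1 - v) * ((∑ b ∈ P ∩ P', w b) - p * p') := mul_nonneg (by linarith) (by linarith)
  nlinarith [hsup, hpair, hHarV, F2, F3, F4]

end Summit.CriticalPhenomena.PercolationContinuityZ3.Theorems.SahiE3ExchangeEmptyLayer
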